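import Summits.BirchSwinnertonDyer.BirchSwinnertonDyer.Theorems.EdixhovenFibreFiveSevenStarredOptimalManinUnitFiveSevenOfSL2NeronValues
import Literature.NumberTheory.PAdicHodge.DualExpOfDeRham
import HarnessLib

/-!
# Route `EdixhovenFibreFiveSeven`, crux K★ `StarredOptimalManinUnitFiveSeven` (stmt-BirchSwinnertonDyer-22226): the conditional
# closer RE-KEYED on the SURJECTIVITY HALF of Kato II Prop. 1.2.3 — the injectivity half is now a theorem

Cell `pub/bsd-wall`, seat `bsd-line-edix-p2` g8 (line `kato-lever`). The F″ programme's final assembly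
`KatoAssemblySocket.kato_neron_five_le_of_sl2NeronValues` (p607805) and the K★ closer
`starredOptimalManinUnitFiveSeven_of_sl2NeronValues` (p608192) display FOUR cite-only facts: P1
`Kato2004.exists_member_sl2ZetaElement_neron_values`, (S5b-tower) `exists_smul_range_expStarCoord_tower_iff_trace_log`,
hP `cupLogInjective_and_hasDualExp_of_isDeRham` (Kato LNM 1553 II Prop. 1.2.3, BOTH halves) and hDR
`isDeRham_restrictedRationalTateRep`. Since `Literature/NumberTheory/PAdicHodge/CupLogInjectiveDeRham` (p608557) PROVES the
injectivity half of Prop. 1.2.3 for every de Rham `V` (`cupLogInjective_of_isDeRham`) and `…/DualExpOfDeRham` records the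
surjectivity half alone as the named fact `hasDualExp_of_isDeRham` with
`cupLogInjective_and_hasDualExp_of_isDeRham_of_hasDualExp : hasDualExp_of_isDeRham → hP`, both theorems are re-keyed here on
the WEAKER hypothesis `hP' : hasDualExp_of_isDeRham`:

* `KatoAssemblySocket.kato_neron_five_le_of_sl2NeronValues_of_hasDualExp (hT₂) (hP') (hDR) (hP1) : F″`;
* `starredOptimalManinUnitFiveSeven_of_sl2NeronValues_of_hasDualExp (hT₂) (hP') (hDR) (hP1) : K★` (conditional closer of
  stmt-BirchSwinnertonDyer-22226; its cite cone is now {P1, (S5b-tower), Kato II 1.2.3 SURJECTIVITY half, de Rham of `V_pE`}).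

CONDITIONAL RESULT (gate audit `proof.conditional`): nothing cite-only is discharged here; the item stays OPEN; BSD is not
proved by any of this.
-/

set_option autoImplicit false
-- the Theorems namespace of a single-conjunct summit repeats the summit name by design (D-0017)
set_option linter.dupNamespace false

noncomputable section

namespace Summit.BirchSwinnertonDyer.BirchSwinnertonDyer.Theorems

/-- **F″ ⟸ P1 + (S5b-tower) + Kato II 1.2.3 (surjectivity half only) + de Rham**: Kato's Néron integrality of twisted
symbol sums at additive `p ≥ 5` (`kato_neron_isIntegral_twistedSymbolSum_of_additive_five_le`), the F″ programme's assembly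
`KatoAssemblySocket.kato_neron_five_le_of_sl2NeronValues` with its hP binder fed by
`cupLogInjective_and_hasDualExp_of_isDeRham_of_hasDualExp` (injectivity half = the theorem `cupLogInjective_of_isDeRham`).
[cite: Kato2004Asterisque, (8.1.3) (p. 180), Thm. 9.7 (p. 189), Thm. 6.6 (1) (p. 163), Thm. 13.6 (p. 227)]
[cite: Kato1993LNM1553, Ch. II Prop. 1.2.3, §1.2.4 and Thm. 1.4.1 (3)-(4)] [cite: BlochKato1990, Prop. 3.8 and Example 3.11] -/
theorem KatoAssemblySocket.kato_neron_five_le_of_sl2NeronValues_of_hasDualExp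
    (hT₂ : Literature.NumberTheory.PAdicHodge.exists_smul_range_expStarCoord_tower_iff_trace_log)
    (hP' : Literature.NumberTheory.PAdicHodge.hasDualExp_of_isDeRham)
    (hDR : Literature.NumberTheory.PAdicHodge.isDeRham_restrictedRationalTateRep)
    (hP1 : Literature.NumberTheory.EllipticCurves.Kato2004.exists_member_sl2ZetaElement_neron_values) :
    Literature.NumberTheory.EllipticCurves.kato_neron_isIntegral_twistedSymbolSum_of_additive_five_le :=
  KatoAssemblySocket.kato_neron_five_le_of_sl2NeronValues hT₂
    (Literature.NumberTheory.PAdicHodge.cupLogInjective_and_hasDualExp_of_isDeRham_of_hasDualExp hP') hDR hP1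

/-- **K★ ⟸ P1 + (S5b-tower) + Kato II 1.2.3 (surjectivity half only) + de Rham** (conditional closer of
stmt-BirchSwinnertonDyer-22226, re-keyed): Manin's `p`-part at the lattice-optimal datum of an `X₀(N)`-optimal curve of
starred additive type at `p ∈ {5, 7}` with `E[p]` irreducible — `starredOptimalManinUnitFiveSeven_of_kato` ∘
`kato_neron_five_le_of_sl2NeronValues_of_hasDualExp`; the injectivity half of Kato II Prop. 1.2.3 is no longer assumed.
[cite: Kato2004Asterisque, (8.1.3) (p. 180), Thm. 9.7 (p. 189), Thm. 6.6 (1) (p. 163), Thm. 13.6 (p. 227)]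
[cite: Kato1993LNM1553, Ch. II Prop. 1.2.3 and Thm. 1.4.1 (3)-(4)] [cite: EdixhovenManin1991, Thm. 3 and §4] -/
theorem starredOptimalManinUnitFiveSeven_of_sl2NeronValues_of_hasDualExp
    (hT₂ : Literature.NumberTheory.PAdicHodge.exists_smul_range_expStarCoord_tower_iff_trace_log)
    (hP' : Literature.NumberTheory.PAdicHodge.hasDualExp_of_isDeRham)
    (hDR : Literature.NumberTheory.PAdicHodge.isDeRham_restrictedRationalTateRep)
    (hP1 : Literature.NumberTheory.EllipticCurves.Kato2004.exists_member_sl2ZetaElement_neron_values) :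
    Summit.BirchSwinnertonDyer.BirchSwinnertonDyer.Theses.EdixhovenFibreFiveSeven.StarredOptimalManinUnitFiveSeven :=
  starredOptimalManinUnitFiveSeven_of_kato
    (KatoAssemblySocket.kato_neron_five_le_of_sl2NeronValues_of_hasDualExp hT₂ hP' hDR hP1)

end Summit.BirchSwinnertonDyer.BirchSwinnertonDyer.Theorems

end
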